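import Literature.Probability.Percolation.ZdFrontierSeparation
import Literature.Probability.Percolation.ZdCornerRings
import Literature.Probability.Percolation.AnnulusCrossingBoundProofs
import Literature.Probability.Percolation.BoxCrossingUpperBound
import Literature.Probability.Percolation.SiteMonotonicity
import HarnessLib

/-!
# Good rings for all objects of one side: the bad event of the external per-scale lemma and its payoff

Topic `Literature/Probability/Percolation`; critical bond percolation on `ℤ²`
(`P = P_{1/2}`), the side rectangle `R = [0,M] × [0,N]` in canonical position. DEFINITIONS with
bodies and PROOFS (no named fact).  The probabilistic half of the EXTERNAL per-scale lemma of
Kesten's arm-separation theorem for four alternating arms (H. Kesten, CMP 109 (1987), §2,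
Lemma 4; P. Nolin, EJP 13 (2008), §4.4, Lemma 15 and its proof, arXiv 0711.4948 p. 11: "each
time we fail, … we then try again … independent of E_u … RSW"), in the cluster–frontier form of
this series (`ZdFrontierEvent`, `ZdFrontierRings`, `ZdFrontierFence`, `ZdCornerRings`):

* the SCALES `fenceScale r k = r 4^k`, `sepScale r K k = r 4^{K+1} 4^k`,
  `cornerScale r K k = r 4^{2K+2} 4^k` (`k < K`): fence rings below separation rings below corner
  rings, each family geometric of ratio `4` (disjoint supports);
* `goodObj M N S r K` — the realised object with frontier `S` has an open FENCE ring and an open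
  SEPARATION ring around its tip among the `K` scales, in the configuration with the pairs below
  `S` opened (`openedOn (belowPairs M N S) (openRing …)`);
* `badOpen M N r K` — some realised open object of `R` is not good; `badDual` — the same for the
  closed-dual objects of the faces inside `R` (`dualConfig ⁻¹' badOpen (M-1) (N-1) r K`);
  `cornerBad` — one of the four corner ring families (open / closed-dual, top / bottom) fails at
  all `K` scales; `sideBad` — their union;
* `real_badOpen_le`, `real_sideBad_le` — `P(sideBad) ≤ 4 (q/(1-q)) (1-c⁴)^K + 4 (1-c²)^K`
  (union bound over the frontier family, `sum_real_frontierEvent_le_of_le`, and the ring bounds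
  `real_frontierEvent_inter_noFenceRing_le`, `real_no(Dual)CornerRing*_le`);
* the deterministic PAYOFFS `payoff_open`, `payoff_dual` — off `sideBad`, every realised object
  (open, or closed-dual) has a fence scale and a separation scale that are good, and its tip is at
  distance `> r 4^{2K+2}` from the two corners of the side.

## References

* H. Kesten, Comm. Math. Phys. 109 (1987), §2, Lemma 4 [KestenScalingCMP1987].
* P. Nolin, EJP 13 (2008), §4.4, Lemma 15 and its proof (arXiv 0711.4948: Lemma 14, p. 11) [Nolin2008].
-/

noncomputable section

open MeasureTheory Set

namespace Literature.Probability.Percolation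

open LatticeModels

variable {M N : ℕ} {ω : BondConfig (Site 2)} {S T : Finset (Sym2 (Site 2))}

/-! ### Scales -/

/-- Fence scales `r 4^k`. [folklore] -/
def fenceScale (r k : ℕ) : ℕ := r * 4 ^ k

/-- Separation scales `r 4^{K+1} 4^k` (all above `4 ×` the fence scales). [folklore] -/
def sepScale (r K k : ℕ) : ℕ := (r * 4 ^ (K + 1)) * 4 ^ k

/-- Corner scales `r 4^{2K+2} 4^k` (all above `4 ×` the separation scales). [folklore] -/
def cornerScale (r K k : ℕ) : ℕ := (r * 4 ^ (2 * K + 2)) * 4 ^ k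

/-- Fence scales are positive. [folklore] -/
theorem one_le_fenceScale {r : ℕ} (hr : 1 ≤ r) (k : ℕ) : 1 ≤ fenceScale r k :=
  Nat.le_mul_of_pos_right _ (by positivity) |>.trans' hr

/-- Fence scales are at most `r 4^{K-1}`. [folklore] -/
theorem fenceScale_le {r k K : ℕ} (hk : k < K) : fenceScale r k ≤ r * 4 ^ (K - 1) :=
  Nat.mul_le_mul_left _ (Nat.pow_le_pow_right (by norm_num) (by omega))

/-- Separation scales are at least `r 4^{K+1}`. [folklore] -/
theorem le_sepScale (r K k : ℕ) : r * 4 ^ (K + 1) ≤ sepScale r K k :=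
  Nat.le_mul_of_pos_right _ (by positivity)

/-- Separation scales are at most `r 4^{2K}`. [folklore] -/
theorem sepScale_le {r k K : ℕ} (hk : k < K) : sepScale r K k ≤ r * 4 ^ (2 * K) := by
  unfold sepScale
  calc r * 4 ^ (K + 1) * 4 ^ k = r * 4 ^ (K + 1 + k) := by rw [pow_add]; ring
    _ ≤ r * 4 ^ (2 * K) := Nat.mul_le_mul_left _ (Nat.pow_le_pow_right (by norm_num) (by omega))

/-- Corner scales are at least `r 4^{2K+2}`. [folklore] -/
theorem le_cornerScale (r K k : ℕ) : r * 4 ^ (2 * K + 2) ≤ cornerScale r K k :=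
  Nat.le_mul_of_pos_right _ (by positivity)

/-- Corner scales are at most `r 4^{3K+1}`. [folklore] -/
theorem cornerScale_le {r k K : ℕ} (hk : k < K) : cornerScale r K k ≤ r * 4 ^ (3 * K + 1) := by
  unfold cornerScale
  calc r * 4 ^ (2 * K + 2) * 4 ^ k = r * 4 ^ (2 * K + 2 + k) := by rw [pow_add]; ring
    _ ≤ r * 4 ^ (3 * K + 1) := Nat.mul_le_mul_left _ (Nat.pow_le_pow_right (by norm_num) (by omega))

/-- `4 ×` the largest fence scale is below every separation scale. [folklore] -/
theorem four_mul_fenceScale_le_sepScale {r k k' K : ℕ} (hk : k < K) : 4 * fenceScale r k ≤ sepScale r K k' := by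
  refine le_trans ?_ (le_sepScale r K k')
  calc 4 * fenceScale r k ≤ 4 * (r * 4 ^ (K - 1)) := Nat.mul_le_mul_left _ (fenceScale_le hk)
    _ = r * 4 ^ (K - 1 + 1) := by rw [pow_succ]; ring
    _ ≤ r * 4 ^ (K + 1) := Nat.mul_le_mul_left _ (Nat.pow_le_pow_right (by norm_num) (by omega))

/-- `4 ×` the largest separation scale is below every corner scale. [folklore] -/
theorem four_mul_sepScale_le_cornerScale {r k k' K : ℕ} (hk : k < K) : 4 * sepScale r K k ≤ cornerScale r K k' := by
  refine le_trans ?_ (le_cornerScale r K k')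
  calc 4 * sepScale r K k ≤ 4 * (r * 4 ^ (2 * K)) := Nat.mul_le_mul_left _ (sepScale_le hk)
    _ = r * 4 ^ (2 * K + 1) := by rw [pow_succ]; ring
    _ ≤ r * 4 ^ (2 * K + 2) := Nat.mul_le_mul_left _ (Nat.pow_le_pow_right (by norm_num) (by omega))

/-! ### The good event of one object and the bad events of a side -/

/-- **The object with frontier `S` is good**: some fence ring and some separation ring around its
tip are open once the pairs below `S` are opened. [cite: Nolin2008, §4.4, proof of Lemma 15 (arXiv 0711.4948: Lemma 14, p. 11)] -/
def goodObj (M N : ℕ) (S : Finset (Sym2 (Site 2))) (r K : ℕ) : Set (BondConfig (Site 2)) :=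
  (⋃ k ∈ Finset.range K, openedOn (belowPairs M N S) (openRing M ((tipOf M N S) 1) (fenceScale r k))) ∩
    ⋃ k ∈ Finset.range K, openedOn (belowPairs M N S) (openRing M ((tipOf M N S) 1) (sepScale r K k))

/-- **Some realised open object of `R` is not good.** [cite: Nolin2008, §4.4, proof of Lemma 15 (arXiv 0711.4948: Lemma 14, p. 11)] -/
def badOpen (M N r K : ℕ) : Set (BondConfig (Site 2)) :=
  ⋃ S ∈ frontierFamily M N, frontierEvent M N S ∩ (goodObj M N S r K)ᶜ

/-- **Some realised closed-dual object of the faces inside `R` is not good.** [cite: Nolin2008, §4.4, proof of Lemma 15 (arXiv 0711.4948: Lemma 14, p. 11)] -/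
def badDual (M N r K : ℕ) : Set (BondConfig (Site 2)) :=
  dualConfig ⁻¹' badOpen (M - 1) (N - 1) r K

/-- **A corner ring family fails.** [cite: Nolin2008, §4.4, proof of Lemma 15 (arXiv 0711.4948: Lemma 14, p. 11)] -/
def cornerBad (M N r K : ℕ) : Set (BondConfig (Site 2)) :=
  ((⋂ k ∈ Finset.range K, (dualCornerRingTop M N (cornerScale r K k))ᶜ) ∪
      ⋂ k ∈ Finset.range K, (dualCornerRingBot M (cornerScale r K k))ᶜ) ∪
    ((⋂ k ∈ Finset.range K, (cornerRingTop M N (cornerScale r K k))ᶜ) ∪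
      ⋂ k ∈ Finset.range K, (cornerRingBot M (cornerScale r K k))ᶜ)

/-- **The bad event of the side.** [cite: Nolin2008, §4.4, proof of Lemma 15 (arXiv 0711.4948: Lemma 14, p. 11)] -/
def sideBad (M N r K : ℕ) : Set (BondConfig (Site 2)) :=
  (badOpen M N r K ∪ badDual M N r K) ∪ cornerBad M N r K

/-! ### Measurability -/

/-- `goodObj` is measurable. [folklore] -/
theorem measurableSet_goodObj (S : Finset (Sym2 (Site 2))) (r K : ℕ) : MeasurableSet (goodObj M N S r K) := by
  refine (MeasurableSet.biUnion (Finset.countable_toSet _) fun k _ => ?_).inter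
    (MeasurableSet.biUnion (Finset.countable_toSet _) fun k _ => ?_) <;>
    exact measurableSet_openedOn (determinedBy_openRing _ _ _) _

/-- `badOpen` is measurable. [folklore] -/
theorem measurableSet_badOpen (hM : 1 ≤ M) (r K : ℕ) : MeasurableSet (badOpen M N r K) := by
  refine MeasurableSet.biUnion (Finset.countable_toSet _) fun S hS => ?_
  have hS' := mem_frontierFamily_iff.1 hS
  exact (measurableSet_frontierEvent hS' hM).inter (measurableSet_goodObj S r K).compl

/-! ### Probability -/

section Probability

/-- **The bad open objects have small probability**:
`P(badOpen) ≤ 2 (q / (1 - q)) (1 - c⁴)^K`, `c` the RSW constant of ratio `7`, `q < 1` a bound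
for the crossing probability of `R`. [cite: Nolin2008, §4.4, proof of Lemma 15 (arXiv 0711.4948: Lemma 14, p. 11)] -/
theorem real_badOpen_le (hM : 1 ≤ M) {c : ℝ} (hc0 : 0 ≤ c) (hc : ∀ l : ℕ, 1 ≤ l → c ≤ crossingProb half (7 * l - 1) (l - 1))
    {q : ℝ} (hq : crossingProb half M N ≤ q) (hq1 : q < 1) {r : ℕ} (hr : 1 ≤ r) (K : ℕ) :
    (bondPercolation (zdGraph 2) half).real (badOpen M N r K) ≤ 2 * (q / (1 - q)) * (1 - c ^ 4) ^ K := by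
  have hpos : 0 ≤ (1 - c ^ 4) ^ K := by
    apply pow_nonneg
    have := (hc 1 le_rfl).trans (measureReal_le_one (μ := bondPercolation (zdGraph 2) half) (s := _))
    nlinarith [pow_le_one₀ hc0 this (n := 4)]
  calc (bondPercolation (zdGraph 2) half).real (badOpen M N r K)
      ≤ ∑ S ∈ frontierFamily M N, (bondPercolation (zdGraph 2) half).real (frontierEvent M N S ∩ (goodObj M N S r K)ᶜ) :=
        measureReal_biUnion_finset_le _ _
    _ ≤ ∑ S ∈ frontierFamily M N, 2 * ((bondPercolation (zdGraph 2) half).real (frontierEvent M N S) * (1 - c ^ 4) ^ K) := by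
        refine Finset.sum_le_sum fun S hS => ?_
        have hS' := mem_frontierFamily_iff.1 hS
        have hsplit : frontierEvent M N S ∩ (goodObj M N S r K)ᶜ ⊆
            (frontierEvent M N S ∩ ⋂ k ∈ Finset.range K,
                (openedOn (belowPairs M N S) (openRing M ((tipOf M N S) 1) (r * 4 ^ k)))ᶜ) ∪
              (frontierEvent M N S ∩ ⋂ k ∈ Finset.range K,
                (openedOn (belowPairs M N S) (openRing M ((tipOf M N S) 1) ((r * 4 ^ (K + 1)) * 4 ^ k)))ᶜ) := by
          rintro ω ⟨hω, hbad⟩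
          rw [goodObj, mem_compl_iff, mem_inter_iff, not_and_or] at hbad
          rcases hbad with h | h
          · left
            refine ⟨hω, ?_⟩
            simpa only [fenceScale, mem_iUnion, not_exists, mem_iInter, mem_compl_iff] using h
          · right
            refine ⟨hω, ?_⟩
            simpa only [sepScale, mem_iUnion, not_exists, mem_iInter, mem_compl_iff] using h
        have hr' : 1 ≤ r * 4 ^ (K + 1) := Nat.le_mul_of_pos_right _ (by positivity) |>.trans' hr
        calc (bondPercolation (zdGraph 2) half).real (frontierEvent M N S ∩ (goodObj M N S r K)ᶜ)
            ≤ (bondPercolation (zdGraph 2) half).real _ := measureReal_mono hsplit (measure_ne_top _ _)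
          _ ≤ (bondPercolation (zdGraph 2) half).real _ + (bondPercolation (zdGraph 2) half).real _ := measureReal_union_le _ _
          _ ≤ (bondPercolation (zdGraph 2) half).real (frontierEvent M N S) * (1 - c ^ 4) ^ K +
                (bondPercolation (zdGraph 2) half).real (frontierEvent M N S) * (1 - c ^ 4) ^ K :=
              add_le_add (real_frontierEvent_inter_noFenceRing_le hS' hM hc0 hc _ hr K)
                (real_frontierEvent_inter_noFenceRing_le hS' hM hc0 hc _ hr' K)
          _ = _ := by ring
    _ = 2 * (1 - c ^ 4) ^ K * ∑ S ∈ frontierFamily M N, (bondPercolation (zdGraph 2) half).real (frontierEvent M N S) := by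
        rw [Finset.mul_sum]; refine Finset.sum_congr rfl fun S _ => by ring
    _ ≤ 2 * (1 - c ^ 4) ^ K * (q / (1 - q)) :=
        mul_le_mul_of_nonneg_left (sum_real_frontierEvent_le_of_le hM hq hq1) (by positivity)
    _ = _ := by ring

/-- **The bad closed-dual objects have small probability** (the law of the dual configuration at
`p = 1/2` is `P_{1/2}`). [cite: Nolin2008, §4.4, proof of Lemma 15 (arXiv 0711.4948: Lemma 14, p. 11)] -/
theorem real_badDual_le (hM : 2 ≤ M) {c : ℝ} (hc0 : 0 ≤ c) (hc : ∀ l : ℕ, 1 ≤ l → c ≤ crossingProb half (7 * l - 1) (l - 1))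
    {q : ℝ} (hq : crossingProb half (M - 1) (N - 1) ≤ q) (hq1 : q < 1) {r : ℕ} (hr : 1 ≤ r) (K : ℕ) :
    (bondPercolation (zdGraph 2) half).real (badDual M N r K) ≤ 2 * (q / (1 - q)) * (1 - c ^ 4) ^ K := by
  rw [badDual, bondPercolation_half_real_preimage_dualConfig (measurableSet_badOpen (by omega) r K)]
  exact real_badOpen_le (by omega) hc0 hc hq hq1 hr K

/-- **The corner families fail with small probability**: `P(cornerBad) ≤ 4 (1 - c²)^K`. [cite: Nolin2008, §4.4, proof of Lemma 15 (arXiv 0711.4948: Lemma 14, p. 11)] -/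
theorem real_cornerBad_le {c : ℝ} (hc0 : 0 ≤ c) (hc : ∀ l : ℕ, 1 ≤ l → c ≤ crossingProb half (7 * l - 1) (l - 1))
    {r : ℕ} (hr : 1 ≤ r) (K : ℕ) :
    (bondPercolation (zdGraph 2) half).real (cornerBad M N r K) ≤ 4 * (1 - c ^ 2) ^ K := by
  have hr' : 1 ≤ r * 4 ^ (2 * K + 2) := Nat.le_mul_of_pos_right _ (by positivity) |>.trans' hr
  have h1 := real_noDualCornerRingTop_le hc0 hc M N hr' K
  have h2 := real_noDualCornerRingBot_le hc0 hc M hr' K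
  have h3 := real_noCornerRingTop_le hc0 hc M N hr' K
  have h4 := real_noCornerRingBot_le hc0 hc M hr' K
  calc (bondPercolation (zdGraph 2) half).real (cornerBad M N r K)
      ≤ (bondPercolation (zdGraph 2) half).real _ + (bondPercolation (zdGraph 2) half).real _ := measureReal_union_le _ _
    _ ≤ ((bondPercolation (zdGraph 2) half).real _ + (bondPercolation (zdGraph 2) half).real _) +
          ((bondPercolation (zdGraph 2) half).real _ + (bondPercolation (zdGraph 2) half).real _) :=
        add_le_add (measureReal_union_le _ _) (measureReal_union_le _ _)
    _ ≤ ((1 - c ^ 2) ^ K + (1 - c ^ 2) ^ K) + ((1 - c ^ 2) ^ K + (1 - c ^ 2) ^ K) :=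
        add_le_add (add_le_add h1 h2) (add_le_add h3 h4)
    _ = _ := by ring

/-- **The bad event of the side has small probability**:
`P(sideBad) ≤ 4 (q/(1-q)) (1-c⁴)^K + 4 (1-c²)^K`. [cite: Nolin2008, §4.4, proof of Lemma 15 (arXiv 0711.4948: Lemma 14, p. 11)] -/
theorem real_sideBad_le (hM : 2 ≤ M) {c : ℝ} (hc0 : 0 ≤ c) (hc : ∀ l : ℕ, 1 ≤ l → c ≤ crossingProb half (7 * l - 1) (l - 1))
    {q : ℝ} (hq : crossingProb half M N ≤ q) (hq' : crossingProb half (M - 1) (N - 1) ≤ q) (hq1 : q < 1)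
    {r : ℕ} (hr : 1 ≤ r) (K : ℕ) :
    (bondPercolation (zdGraph 2) half).real (sideBad M N r K) ≤ 4 * (q / (1 - q)) * (1 - c ^ 4) ^ K + 4 * (1 - c ^ 2) ^ K := by
  calc (bondPercolation (zdGraph 2) half).real (sideBad M N r K)
      ≤ (bondPercolation (zdGraph 2) half).real _ + (bondPercolation (zdGraph 2) half).real _ := measureReal_union_le _ _
    _ ≤ ((bondPercolation (zdGraph 2) half).real _ + (bondPercolation (zdGraph 2) half).real _) +
          (bondPercolation (zdGraph 2) half).real _ := add_le_add (measureReal_union_le _ _) le_rfl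
    _ ≤ (2 * (q / (1 - q)) * (1 - c ^ 4) ^ K + 2 * (q / (1 - q)) * (1 - c ^ 4) ^ K) + 4 * (1 - c ^ 2) ^ K :=
        add_le_add (add_le_add (real_badOpen_le (by omega) hc0 hc hq hq1 hr K) (real_badDual_le hM hc0 hc hq' hq1 hr K))
          (real_cornerBad_le hc0 hc hr K)
    _ = _ := by ring

end Probability

/-! ### Locality: the side events read pairs in a window to the right of the line `x = 0` -/

section Locality

/-- The pairs read by the side events: both endpoints in the window
`[0, M + 2ρ + 1] × [-3ρ - 2, N + 3ρ + 1]`, `ρ = r 4^{3K+1}` the largest scale. [folklore] -/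
def sidePairs (M N r K : ℕ) : Finset (Sym2 (Site 2)) :=
  (Finset.Icc (![0, -(3 * (r * 4 ^ (3 * K + 1) : ℕ) : ℤ) - 2] : Site 2)
    ![(M : ℤ) + 2 * (r * 4 ^ (3 * K + 1) : ℕ) + 1, (N : ℤ) + 3 * (r * 4 ^ (3 * K + 1) : ℕ) + 1]).sym2

/-- Membership in `sidePairs` from coordinate bounds on both endpoints. [folklore] -/
theorem mem_sidePairs_iff {r K : ℕ} {e : Sym2 (Site 2)} :
    e ∈ sidePairs M N r K ↔ ∀ v ∈ e, 0 ≤ v 0 ∧ v 0 ≤ (M : ℤ) + 2 * (r * 4 ^ (3 * K + 1) : ℕ) + 1 ∧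
      -(3 * (r * 4 ^ (3 * K + 1) : ℕ) : ℤ) - 2 ≤ v 1 ∧ v 1 ≤ (N : ℤ) + 3 * (r * 4 ^ (3 * K + 1) : ℕ) + 1 := by
  rw [sidePairs, Finset.mem_sym2_iff]
  refine forall₂_congr fun v _ => ?_
  rw [Finset.mem_Icc]
  simp only [Pi.le_def, Fin.forall_fin_two, Matrix.cons_val_zero, Matrix.cons_val_one]
  tauto

/-- **Every pair read by the side events has both endpoints of nonnegative abscissa.** [folklore] -/
theorem apply_zero_nonneg_of_mem_sidePairs {r K : ℕ} {e : Sym2 (Site 2)} (he : e ∈ sidePairs M N r K) :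
    ∀ v ∈ e, 0 ≤ v 0 := fun v hv => (mem_sidePairs_iff.1 he v hv).1

variable {r K : ℕ}

/-- The below pairs of a set of pairs lie in the window. [folklore] -/
theorem belowPairs_subset_sidePairs (S : Finset (Sym2 (Site 2))) : belowPairs M N S ⊆ sidePairs M N r K := by
  intro e he
  obtain ⟨g, hg, hge⟩ := mem_belowPairs_iff.1 he
  have hgR := mem_dualRectangle_iff.1 (belowFaces_subset hg)
  rw [mem_sidePairs_iff]
  intro v hv
  simp only [squareEdges, Finset.mem_insert, Finset.mem_singleton] at hge
  have hpos : (0 : ℤ) ≤ (r * 4 ^ (3 * K + 1) : ℕ) := by positivity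
  rcases hge with rfl | rfl | rfl | rfl <;> rcases Sym2.mem_iff.1 hv with rfl | rfl <;>
    (try simp only [Pi.add_apply, single_zero_apply_zero, single_zero_apply_one, single_one_apply_zero,
      single_one_apply_one]) <;> omega

/-- The ring pairs at an admissible scale around a tip inside `R` lie in the window. [folklore] -/
theorem ringSites_sym2_subset_sidePairs {t : ℤ} (ht : 0 ≤ t ∧ t ≤ N) {ρ : ℕ} (hρ : ρ ≤ r * 4 ^ (3 * K + 1))
    (hρM : 2 * ρ ≤ M) : (ringSites M t ρ).sym2 ⊆ sidePairs M N r K := by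
  intro e he
  rw [mem_sidePairs_iff]
  intro v hv
  obtain ⟨⟨h1, h2, h3, h4⟩, -⟩ := mem_ringSites_iff.1 (Finset.mem_sym2_iff.1 he v hv)
  have hρ' : (ρ : ℤ) ≤ (r * 4 ^ (3 * K + 1) : ℕ) := by exact_mod_cast hρ
  omega

/-- The corner pairs at an admissible scale lie in the window. [folklore] -/
theorem cornerSitesTop_sym2_subset_sidePairs {ρ : ℕ} (hρ : ρ ≤ r * 4 ^ (3 * K + 1)) (hρM : 2 * ρ ≤ M) :
    (cornerSitesTop M N ρ).sym2 ⊆ sidePairs M N r K := by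
  intro e he
  rw [mem_sidePairs_iff]
  intro v hv
  obtain ⟨⟨h1, h2, h3, h4⟩, -⟩ := mem_cornerSitesTop_iff.1 (Finset.mem_sym2_iff.1 he v hv)
  have hρ' : (ρ : ℤ) ≤ (r * 4 ^ (3 * K + 1) : ℕ) := by exact_mod_cast hρ
  omega

/-- The bottom corner pairs at an admissible scale lie in the window. [folklore] -/
theorem cornerSitesBot_sym2_subset_sidePairs {ρ : ℕ} (hρ : ρ ≤ r * 4 ^ (3 * K + 1)) (hρM : 2 * ρ ≤ M) :
    (cornerSitesBot M ρ).sym2 ⊆ sidePairs M N r K := by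
  intro e he
  rw [mem_sidePairs_iff]
  intro v hv
  obtain ⟨⟨h1, h2, h3, h4⟩, -⟩ := mem_cornerSitesBot_iff.1 (Finset.mem_sym2_iff.1 he v hv)
  have hρ' : (ρ : ℤ) ≤ (r * 4 ^ (3 * K + 1) : ℕ) := by exact_mod_cast hρ
  omega

/-- **The dual-edge preimage of the window of `(M-1, N-1)` lies in the window of `(M, N)`.** [folklore] -/
theorem dualEdge_preimage_sidePairs_subset (hM : 1 ≤ M) (hN : 1 ≤ N) :
    dualEdge ⁻¹' (↑(sidePairs (M - 1) (N - 1) r K) : Set (Sym2 (Site 2))) ⊆ ↑(sidePairs M N r K) := by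
  intro e he
  rw [mem_preimage, Finset.mem_coe, mem_sidePairs_iff] at he
  rw [Finset.mem_coe, mem_sidePairs_iff]
  have hcM : ((M - 1 : ℕ) : ℤ) = M - 1 := by push_cast [Nat.cast_sub hM]; ring
  have hcN : ((N - 1 : ℕ) : ℤ) = N - 1 := by push_cast [Nat.cast_sub hN]; ring
  rw [hcM, hcN] at he
  by_cases heE : e ∈ (zdGraph 2).edgeSet
  · obtain ⟨u, i, hi⟩ := mem_edgeSet_zdGraph_iff.1 heE
    rcases (Fin.exists_fin_two (p := fun j : Fin 2 => e = s(u, u + Pi.single j 1))).1 ⟨i, hi⟩ with rfl | rfl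
    · -- horizontal edge `{u, u + e₀}`: dual `{u - e₁, u}`
      intro v hv
      rw [dualEdge_horizontal] at he
      have h1 := he u (Sym2.mem_mk_right _ _)
      rcases Sym2.mem_iff.1 hv with rfl | rfl
      · omega
      · simp only [Pi.add_apply, single_zero_apply_zero, single_zero_apply_one]; omega
    · intro v hv
      rw [dualEdge_vertical] at he
      have h1 := he u (Sym2.mem_mk_right _ _)
      rcases Sym2.mem_iff.1 hv with rfl | rfl
      · omega
      · simp only [Pi.add_apply, single_one_apply_zero, single_one_apply_one]; omega
  · rw [dualEdge_of_not_mem heE] at he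
    intro v hv
    have := he v hv
    omega

/-- Unions of determined events are determined. [folklore] -/
theorem determinedBy_union_of {A B : Set (BondConfig (Site 2))} {F : Set (Sym2 (Site 2))} (hA : DeterminedBy A F)
    (hB : DeterminedBy B F) : DeterminedBy (A ∪ B) F := by
  have h := (hA.compl.inter hB.compl).compl
  rwa [← Set.compl_union, compl_compl] at h

/-- **Locality of the side events**: `sideBad M N r K` is determined by the pairs of the window
(`2 r 4^{3K+1} + 1 ≤ M`, `M ≥ 2`, `N ≥ 1`). [cite: Nolin2008, §4.4, proof of Lemma 15 (arXiv 0711.4948: Lemma 14, p. 11: "independent from the status of the sites above")] -/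
theorem determinedBy_sideBad (hM : 2 ≤ M) (hN : 1 ≤ N) (hr : 1 ≤ r) (hscale : 2 * (r * 4 ^ (3 * K + 1)) + 1 ≤ M) :
    DeterminedBy (sideBad M N r K) ↑(sidePairs M N r K) := by
  -- one side, open objects, any `(M', N')` with the scale condition
  have hopen : ∀ M' N', 1 ≤ M' → 2 * (r * 4 ^ (3 * K + 1)) + 1 ≤ M' + 1 →
      DeterminedBy (badOpen M' N' r K) ↑(sidePairs M' N' r K) := by
    intro M' N' hM' hscale'
    refine DeterminedBy.iUnion fun S => DeterminedBy.iUnion fun hS => ?_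
    have hS' := mem_frontierFamily_iff.1 hS
    have htip := mem_rectangle_iff.1 (hS'.tipOf_mem_rectangle hM')
    have hring : ∀ ρ, ρ ≤ r * 4 ^ (2 * K) → DeterminedBy (openedOn (belowPairs M' N' S) (openRing M' ((tipOf M' N' S) 1) ρ))
        ↑(sidePairs M' N' r K) := by
      intro ρ hρ
      have hρ' : ρ ≤ r * 4 ^ (3 * K + 1) := hρ.trans (Nat.mul_le_mul_left _ (Nat.pow_le_pow_right (by norm_num) (by omega)))
      have h4 : 4 * (r * 4 ^ (2 * K)) ≤ r * 4 ^ (3 * K + 1) := by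
        calc 4 * (r * 4 ^ (2 * K)) = r * 4 ^ (2 * K + 1) := by rw [pow_succ]; ring
          _ ≤ r * 4 ^ (3 * K + 1) := Nat.mul_le_mul_left _ (Nat.pow_le_pow_right (by norm_num) (by omega))
      refine (determinedBy_openedOn (determinedBy_openRing M' _ ρ) _).mono ?_
      rw [Finset.coe_subset]
      exact Finset.sdiff_subset.trans (ringSites_sym2_subset_sidePairs ⟨htip.2.2.1, htip.2.2.2⟩ hρ' (by omega))
    refine ((determinedBy_frontierEvent hS' hM').mono (Finset.coe_subset.2 (belowPairs_subset_sidePairs S))).inter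
      (DeterminedBy.compl ?_)
    refine (DeterminedBy.iUnion fun k => DeterminedBy.iUnion fun hk => hring _ ?_).inter
      (DeterminedBy.iUnion fun k => DeterminedBy.iUnion fun hk => hring _ ?_)
    · exact (fenceScale_le (Finset.mem_range.1 hk)).trans (Nat.mul_le_mul_left _ (Nat.pow_le_pow_right (by norm_num) (by omega)))
    · exact sepScale_le (Finset.mem_range.1 hk)
  have hcs : ∀ k ∈ Finset.range K, cornerScale r K k ≤ r * 4 ^ (3 * K + 1) ∧ 1 ≤ cornerScale r K k := fun k hk =>
    ⟨cornerScale_le (Finset.mem_range.1 hk),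
      Nat.le_mul_of_pos_right _ (by positivity) |>.trans' (Nat.le_mul_of_pos_right _ (by positivity) |>.trans' hr)⟩
  refine determinedBy_union_of (determinedBy_union_of (hopen M N (by omega) (by omega)) ?_) ?_
  · -- dual objects
    refine ((hopen (M - 1) (N - 1) (by omega) (by omega)).preimage_dualConfig).mono ?_
    exact dualEdge_preimage_sidePairs_subset (by omega) hN
  · refine determinedBy_union_of (determinedBy_union_of ?_ ?_) (determinedBy_union_of ?_ ?_) <;>
      refine DeterminedBy.iInter fun k => DeterminedBy.iInter fun hk => DeterminedBy.compl ?_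
    · exact (determinedBy_dualCornerRingTop M N (hcs k hk).2).mono
        (Finset.coe_subset.2 (cornerSitesTop_sym2_subset_sidePairs (hcs k hk).1 (by have := (hcs k hk).1; omega)))
    · exact (determinedBy_dualCornerRingBot M (hcs k hk).2).mono
        (Finset.coe_subset.2 (cornerSitesBot_sym2_subset_sidePairs (hcs k hk).1 (by have := (hcs k hk).1; omega)))
    · exact (determinedBy_cornerRingTop M N _).mono
        (Finset.coe_subset.2 (cornerSitesTop_sym2_subset_sidePairs (hcs k hk).1 (by have := (hcs k hk).1; omega)))
    · exact (determinedBy_cornerRingBot M _).mono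
        (Finset.coe_subset.2 (cornerSitesBot_sym2_subset_sidePairs (hcs k hk).1 (by have := (hcs k hk).1; omega)))

/-- `sideBad` is measurable. [folklore] -/
theorem measurableSet_sideBad (hM : 2 ≤ M) (hN : 1 ≤ N) (hr : 1 ≤ r) (hscale : 2 * (r * 4 ^ (3 * K + 1)) + 1 ≤ M) :
    MeasurableSet (sideBad M N r K) :=
  (determinedBy_sideBad hM hN hr hscale).measurableSet_of_finset

end Locality

/-! ### The deterministic payoff -/

section Payoff

/-- **Payoff for an open object**: off the bad events, a realised open object with frontier `S`
has a good fence scale `k_f` and a good separation scale `k_s`, and its tip is farther than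
`r 4^{2K+2}` from both corners of the side. [cite: Nolin2008, §4.4, proof of Lemma 15 (arXiv 0711.4948: Lemma 14, p. 11)] -/
theorem payoff_open (hS : IsFrontierSet M N S) (hM : 1 ≤ M) (hω : ω ∈ frontierEvent M N S) {r K : ℕ} (hr : 1 ≤ r)
    (hscale : 2 * (r * 4 ^ (3 * K + 1)) + 1 ≤ M)
    (hbad : ω ∉ badOpen M N r K) (hcorner : ω ∉ cornerBad M N r K) :
    (∃ kf ∈ Finset.range K, ω ∈ openedOn (belowPairs M N S) (openRing M ((tipOf M N S) 1) (fenceScale r kf))) ∧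
      (∃ ks ∈ Finset.range K, ω ∈ openedOn (belowPairs M N S) (openRing M ((tipOf M N S) 1) (sepScale r K ks))) ∧
      ((r * 4 ^ (2 * K + 2) : ℕ) : ℤ) + 1 ≤ (tipOf M N S) 1 ∧ (tipOf M N S) 1 + (r * 4 ^ (2 * K + 2) : ℕ) + 1 ≤ N := by
  -- good rings
  have hgood : ω ∈ goodObj M N S r K := by
    by_contra h
    exact hbad (mem_iUnion₂.2 ⟨S, mem_frontierFamily_iff.2 hS, hω, h⟩)
  obtain ⟨hf, hs⟩ := hgood
  rw [mem_iUnion₂] at hf hs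
  obtain ⟨kf, hkf, hkf'⟩ := hf
  obtain ⟨ks, hks, hks'⟩ := hs
  refine ⟨⟨kf, hkf, hkf'⟩, ⟨ks, hks, hks'⟩, ?_, ?_⟩
  · -- bottom corner: some closed-dual bottom corner ring is present
    have h : ¬ ∀ k ∈ Finset.range K, ω ∉ dualCornerRingBot M (cornerScale r K k) := by
      intro h
      exact hcorner (Or.inl (Or.inr (mem_iInter₂.2 fun k hk => h k hk)))
    push Not at h
    obtain ⟨k, hk, hring⟩ := h
    have hk' := Finset.mem_range.1 hk
    have h1 : 1 ≤ cornerScale r K k := Nat.le_mul_of_pos_right _ (by positivity) |>.trans'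
      (Nat.le_mul_of_pos_right _ (by positivity) |>.trans' hr)
    have hle := cornerScale_le (r := r) hk'
    have := hS.lt_tipOf_of_dualCornerRingBot hM hω h1 (by omega) hring
    have hge := le_cornerScale r K k
    have hge' : ((r * 4 ^ (2 * K + 2) : ℕ) : ℤ) ≤ ((cornerScale r K k : ℕ) : ℤ) := by exact_mod_cast hge
    omega
  · have h : ¬ ∀ k ∈ Finset.range K, ω ∉ dualCornerRingTop M N (cornerScale r K k) := by
      intro h
      exact hcorner (Or.inl (Or.inl (mem_iInter₂.2 fun k hk => h k hk)))
    push Not at h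
    obtain ⟨k, hk, hring⟩ := h
    have hk' := Finset.mem_range.1 hk
    have h1 : 1 ≤ cornerScale r K k := Nat.le_mul_of_pos_right _ (by positivity) |>.trans'
      (Nat.le_mul_of_pos_right _ (by positivity) |>.trans' hr)
    have hle := cornerScale_le (r := r) hk'
    have := hS.tipOf_add_lt_of_dualCornerRingTop hM hω h1 (by omega) hring
    have hge := le_cornerScale r K k
    have hge' : ((r * 4 ^ (2 * K + 2) : ℕ) : ℤ) ≤ ((cornerScale r K k : ℕ) : ℤ) := by exact_mod_cast hge
    omega

/-- **Payoff for a closed-dual object** (frontier `T` of the faces inside `R`, dual frame). [cite: Nolin2008, §4.4, proof of Lemma 15 (arXiv 0711.4948: Lemma 14, p. 11)] -/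
theorem payoff_dual (hT : IsFrontierSet (M - 1) (N - 1) T) (hM : 2 ≤ M) (hN : 1 ≤ N) (hωE : ω ⊆ (zdGraph 2).edgeSet)
    (hωT : dualConfig ω ∈ frontierEvent (M - 1) (N - 1) T) {r K : ℕ} (hr : 1 ≤ r)
    (hscale : 2 * (r * 4 ^ (3 * K + 1)) + 1 ≤ M)
    (hbad : ω ∉ badDual M N r K) (hcorner : ω ∉ cornerBad M N r K) :
    (∃ kf ∈ Finset.range K, dualConfig ω ∈ openedOn (belowPairs (M - 1) (N - 1) T)
        (openRing (M - 1) ((tipOf (M - 1) (N - 1) T) 1) (fenceScale r kf))) ∧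
      (∃ ks ∈ Finset.range K, dualConfig ω ∈ openedOn (belowPairs (M - 1) (N - 1) T)
        (openRing (M - 1) ((tipOf (M - 1) (N - 1) T) 1) (sepScale r K ks))) ∧
      ((r * 4 ^ (2 * K + 2) : ℕ) : ℤ) ≤ (tipOf (M - 1) (N - 1) T) 1 ∧
        (tipOf (M - 1) (N - 1) T) 1 + (r * 4 ^ (2 * K + 2) : ℕ) + 1 ≤ N := by
  have hgood : dualConfig ω ∈ goodObj (M - 1) (N - 1) T r K := by
    by_contra h
    exact hbad (mem_iUnion₂.2 ⟨T, mem_frontierFamily_iff.2 hT, hωT, h⟩)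
  obtain ⟨hf, hs⟩ := hgood
  rw [mem_iUnion₂] at hf hs
  obtain ⟨kf, hkf, hkf'⟩ := hf
  obtain ⟨ks, hks, hks'⟩ := hs
  refine ⟨⟨kf, hkf, hkf'⟩, ⟨ks, hks, hks'⟩, ?_, ?_⟩
  · have h : ¬ ∀ k ∈ Finset.range K, ω ∉ cornerRingBot M (cornerScale r K k) := by
      intro h
      exact hcorner (Or.inr (Or.inr (mem_iInter₂.2 fun k hk => h k hk)))
    push Not at h
    obtain ⟨k, hk, hring⟩ := h
    have hk' := Finset.mem_range.1 hk
    have h1 : 1 ≤ cornerScale r K k := Nat.le_mul_of_pos_right _ (by positivity) |>.trans'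
      (Nat.le_mul_of_pos_right _ (by positivity) |>.trans' hr)
    have hle := cornerScale_le (r := r) hk'
    have := hT.le_tipOf_of_cornerRingBot hM hN hωE hωT h1 (by omega) hring
    have hge := le_cornerScale r K k
    have hge' : ((r * 4 ^ (2 * K + 2) : ℕ) : ℤ) ≤ ((cornerScale r K k : ℕ) : ℤ) := by exact_mod_cast hge
    omega
  · have h : ¬ ∀ k ∈ Finset.range K, ω ∉ cornerRingTop M N (cornerScale r K k) := by
      intro h
      exact hcorner (Or.inr (Or.inl (mem_iInter₂.2 fun k hk => h k hk)))
    push Not at h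
    obtain ⟨k, hk, hring⟩ := h
    have hk' := Finset.mem_range.1 hk
    have h1 : 1 ≤ cornerScale r K k := Nat.le_mul_of_pos_right _ (by positivity) |>.trans'
      (Nat.le_mul_of_pos_right _ (by positivity) |>.trans' hr)
    have hle := cornerScale_le (r := r) hk'
    have := hT.tipOf_add_lt_of_cornerRingTop hM hN hωE hωT h1 (by omega) hring
    have hge := le_cornerScale r K k
    have hge' : ((r * 4 ^ (2 * K + 2) : ℕ) : ℤ) ≤ ((cornerScale r K k : ℕ) : ℤ) := by exact_mod_cast hge
    omega

end Payoff

end Literature.Probability.Percolation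

end
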